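import Summits.BirchSwinnertonDyer.Rank1Residual.Additive.RamifiedOrdinaryLineExactOrder
import Summits.BirchSwinnertonDyer.Rank1Residual.Additive.RamifiedOrdinaryLineInertiaScalars
import Literature.NumberTheory.GaloisRepresentations.FundamentalCharacterCyclotomicProofs
import Literature.NumberTheory.EllipticCurves.KodairaNeronUnramifiedInertiaProofs
import HarnessLib

/-!
# The quotient scalar of a local inertia element on the ramified ordinary line has the SAME ORDER as
# `χ̄_p(σ)^{(p−1)/e}` — Kummer versus cyclotomic on `I_v`, per `σ` (Gord_e346, `p ≥ 5`, `e ∈ {3,4,6}`)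
# (cell `b2b-bsdres`, team n1011, seat p07 (gen 8); row T-ROL-ORD addendum; r2 §II.27 READING R-M)

HONEST FRAMING (cell `b2b-bsdres`, run/shared/lean/b2b/bsd-rank1-residual/, verbatim in every
file): the goal of the cell is to DELETE the COMBINATION-SHAPED residual classes of the
Birch–Swinnerton-Dyer formula for ALL analytic-rank `≤ 1` elliptic curves over `ℚ` — "full BSD
formula for every rank `≤ 1` curve in class `C`" assembled STRICTLY from published theorems — so
that the rank-`≤ 1` remainder becomes exactly the CONSTRUCTION-SHAPED classes, which are TYPED
(missing-input `Prop`s), NOT attempted. This is not "finishing BSD". Team n1011 (N10/N11): research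
route on the CONSTRUCTION-SHAPED classes X3♯(G-ord)/X4♯(G-ord); prove what is provable now; no
claim beyond stated classes; census output = EVIDENCE, never a Literature fact; RESIDUAL-MAP marks
UNCHANGED; nothing is booked by this file. TOOL theorems only: NO definition, NO named fact, NO
conjecture node.

## What and why

FILE F3b (`RamifiedOrdinaryLineExactOrder`): on a (G-ord) row at `p ≥ 5` with `e = semistabilityIndex W p ≠ 2`,
an inertial `σ` acts trivially on `E[p^∞]/C` iff `σ θ = θ` (`θ^e = p`), and fixing ONE non-zero
vector is already trivial (freeness). r2's READING R-M (ROUTE-2 §II.27, EVIDENCE on 5 922 links: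
"quotient exponent `i = (p−1)·v_p(Δ_min)/12 mod (p−1)`") and cc-typer-2's parity dictionary (TT
v2.1) ask how the quotient character sits against the cyclotomic character. This file proves the
per-`σ` ORDER statement, with no character theory:

* §1 **`specVal_smul_div_sub_pow_lt_one`** — KUMMER VERSUS CYCLOTOMIC ON INERTIA: for `θ ∈ K̄_v` with
  `θ^e = p`, `e·f = p − 1`, a primitive `p`-th root of unity `ζ`, and `σ ∈ I_v` with `σ ζ = ζ^N`:
  `σ(θ)/θ ≡ N^f (mod 𝔪_w)` (`‖θ‖ = ‖(ζ − 1)^f‖` by `algNorm_one_sub_primitiveRoot_pow`; the action of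
  `I_v` modulo `𝔪` only sees `‖·‖`, `residue_smul_div_eq_of_algNorm_eq`; `σ(ζ−1)/(ζ−1) ≡ N`).
* §2 **`IsRamifiedOrdinaryLine.quotScalar_pow_eq_one_iff`** — for EVERY ramified ordinary line `L`,
  every `σ ∈ I_v`, its quotient scalar `b` on `(E[p^∞]/C)[p]` (cc-typer-2's S3 `exists_quotScalar`)
  and `N` with `σ ζ = ζ^N`: **`b^d = 1 ↔ (N^{(p−1)/e})^d = 1` in `ℤ/p`, for every `d`** — the quotient
  scalar and `χ̄_p(σ)^{(p−1)/e}` generate the same subgroup of `𝔽_pˣ` (F3b + §1). Class forms.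

HONEST LIMIT: an ORDER statement per `σ`, not the identification `ϑ̄ = ω^{±m'(p−1)/e}` as characters;
`e = 2` and `p ≤ 3` untouched. References: Serre, Invent. Math. 15 (1972) §1.7–1.8, §5.6 [Serre1972];
Serre–Tate, Ann. of Math. 88 (1968) §2 [SerreTate1968]; Greenberg–Vatsal (2000) §2 p. 26
[GreenbergVatsal2000]; cells/n1011/ROUTE-2.md §II.27; class-closure/N10/TRANSPORT-TEMPLATE.md v2.1.
-/

set_option autoImplicit false

noncomputable section

open scoped Classical NNReal NumberField Valued

open WeierstrassCurve

universe u

namespace Summit.BirchSwinnertonDyer.Rank1Residual.Additive.GoodModelLine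

open NumberField IsDedekindDomain Field IsDedekindDomain.HeightOneSpectrum
  Literature.NumberTheory.GaloisRepresentations
  Literature.NumberTheory.GaloisRepresentations.IsNonarchimedeanLocalField
  Literature.NumberTheory.EllipticCurves
  Summit.BirchSwinnertonDyer.Rank1Residual.X2.GreenbergVatsalReductionDatum

/-! ## §1 Kummer versus cyclotomic on the inertia group -/

section KummerCyclotomic

variable (p : ℕ) [hp : Fact p.Prime] {v : HeightOneSpectrum (𝓞 ℚ)}

/-- Natural numbers have spectral valuation `≤ 1`. [folklore] -/
theorem specVal_natCast_le_one (n : ℕ) :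
    specVal v ((n : ℕ) : AlgebraicClosure (v.adicCompletion ℚ)) ≤ 1 := by
  induction n with
  | zero => simp
  | succ n ih =>
    rw [Nat.cast_succ]
    exact (Valuation.map_add _ _ _).trans (max_le ih (by rw [map_one]))

/-- `(M : ℤ/p) = 1 ↔ |M − 1|_v < 1` for a natural number `M ≥ 1` (`𝔪_w ∩ ℤ = pℤ`). [folklore] -/
theorem natCast_zmod_eq_one_iff_specVal_sub_one_lt_one (hpv : ((p : ℕ) : 𝓞 ℚ) ∈ v.asIdeal)
    {M : ℕ} (hM : 1 ≤ M) :
    ((M : ℕ) : ZMod p) = 1 ↔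
      specVal v (((M : ℕ) : AlgebraicClosure (v.adicCompletion ℚ)) - 1) < 1 := by
  set L := AlgebraicClosure (v.adicCompletion ℚ)
  have hcast : ((M : ℕ) : L) - 1 = ((M - 1 : ℕ) : L) := by
    rw [Nat.cast_sub hM, Nat.cast_one]
  have hzmod : ((M : ℕ) : ZMod p) = 1 ↔ p ∣ M - 1 := by
    rw [← Nat.cast_one, ZMod.natCast_eq_natCast_iff, Nat.ModEq, Nat.one_mod_eq_one.mpr hp.out.ne_one]
    constructor
    · intro h
      exact (Nat.modEq_iff_dvd' hM).mp (by rw [Nat.ModEq, Nat.one_mod_eq_one.mpr hp.out.ne_one, h])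
    · intro h
      have := (Nat.modEq_iff_dvd' hM).mpr h
      rw [Nat.ModEq, Nat.one_mod_eq_one.mpr hp.out.ne_one] at this
      exact this.symm
  rw [hzmod, hcast]
  constructor
  · rintro ⟨k, hk⟩
    rw [hk, Nat.cast_mul, map_mul]
    calc specVal v ((p : ℕ) : L) * specVal v ((k : ℕ) : L)
        ≤ specVal v ((p : ℕ) : L) * 1 := mul_le_mul' le_rfl (specVal_natCast_le_one (v := v) k)
      _ < 1 := by
        rw [mul_one]
        exact spectralValuation_natCast_lt_one (specVal_spec v) hpv
  · intro hlt
    by_contra hnd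
    have hnd' : ¬ (p : ℤ) ∣ ((M - 1 : ℕ) : ℤ) := fun h ↦ hnd (by exact_mod_cast h)
    have h1 := spectralValuation_intCast_eq_one_of_natCast_mem hpv (specVal_spec v) hnd'
    rw [Int.cast_natCast] at h1
    rw [h1] at hlt
    exact lt_irrefl _ hlt

/-- Congruent integral elements have congruent powers: `|x − y| < 1 ⟹ |x^n − y^n| < 1` for
`|x|, |y| ≤ 1`. [folklore] -/
theorem specVal_pow_sub_pow_lt_one {x y : AlgebraicClosure (v.adicCompletion ℚ)}
    (hx : specVal v x ≤ 1) (hy : specVal v y ≤ 1) (h : specVal v (x - y) < 1) (n : ℕ) :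
    specVal v (x ^ n - y ^ n) < 1 := by
  have hvO : (specVal v).Integers (specVal v).valuationSubring := Valuation.valuationSubring.integers _
  set X : (specVal v).valuationSubring := ⟨x, (Valuation.mem_valuationSubring_iff _ _).mpr hx⟩
  set Y : (specVal v).valuationSubring := ⟨y, (Valuation.mem_valuationSubring_iff _ _).mpr hy⟩
  have hXY : IsLocalRing.residue _ X = IsLocalRing.residue _ Y := by
    rw [← sub_eq_zero, ← map_sub, IsLocalRing.residue_eq_zero_iff, IsLocalRing.mem_maximalIdeal,
      mem_nonunits_iff, hvO.isUnit_iff_valuation_eq_one]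
    exact ne_of_lt h
  have hn : IsLocalRing.residue _ (X ^ n) = IsLocalRing.residue _ (Y ^ n) := by rw [map_pow, map_pow, hXY]
  rw [← sub_eq_zero, ← map_sub, IsLocalRing.residue_eq_zero_iff, IsLocalRing.mem_maximalIdeal,
    mem_nonunits_iff, hvO.isUnit_iff_valuation_eq_one] at hn
  have hle : specVal v (((X ^ n - Y ^ n : (specVal v).valuationSubring)) :
      AlgebraicClosure (v.adicCompletion ℚ)) ≤ 1 :=
    (Valuation.mem_valuationSubring_iff _ _).mp (X ^ n - Y ^ n).2
  have hcoe : (((X ^ n - Y ^ n : (specVal v).valuationSubring)) : AlgebraicClosure (v.adicCompletion ℚ)) =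
      x ^ n - y ^ n := by
    simp [X, Y]
  rw [← hcoe]
  exact lt_of_le_of_ne hle hn

/-- **KUMMER VERSUS CYCLOTOMIC ON THE INERTIA GROUP.** `v ∋ p`, `θ ∈ K̄_v` with `θ^e = p`,
`e · f = p − 1`, `ζ` a primitive `p`-th root of unity, `σ ∈ I_v` with `σ ζ = ζ^N`. Then
`σ(θ)/θ ≡ N^f (mod 𝔪_w)`: `|σ(θ)/θ − N^f|_v < 1`. (`‖θ‖ = ‖p‖^{1/e} = ‖(ζ − 1)^f‖` since
`‖ζ − 1‖^{p−1} = ‖p‖`; the Kummer character of inertia only sees absolute values; and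
`σ(ζ − 1)/(ζ − 1) = 1 + ζ + ⋯ + ζ^{N−1} ≡ N`.) Serre 1972 §1.8 Prop. 8 / Cor. (`θ_{p−1} = χ` when
`e(F) = 1`) raised to the power `f = (p−1)/e`. [cite: Serre1972, §1.7 Prop. 3 and §1.8 Prop. 8]
[cite: NeukirchANT1999, Ch. II (7.13)] -/
theorem specVal_smul_div_sub_pow_lt_one (hpv : ((p : ℕ) : 𝓞 ℚ) ∈ v.asIdeal) {e f : ℕ} (he0 : e ≠ 0)
    (hef : e * f = p - 1) {θ : AlgebraicClosure (v.adicCompletion ℚ)}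
    (hθ : θ ^ e = ((p : ℕ) : AlgebraicClosure (v.adicCompletion ℚ)))
    {ζ : AlgebraicClosure (v.adicCompletion ℚ)} (hζ : IsPrimitiveRoot ζ p)
    {σ : absoluteGaloisGroup (v.adicCompletion ℚ)} (hσ : σ ∈ absInertia (v.adicCompletion ℚ))
    {N : ℕ} (hN : σ • ζ = ζ ^ N) :
    specVal v (σ • θ / θ - ((N : ℕ) : AlgebraicClosure (v.adicCompletion ℚ)) ^ f) < 1 := by
  let F := v.adicCompletion ℚ
  let L := AlgebraicClosure (v.adicCompletion ℚ)
  haveI : CharZero L := charZero_of_injective_algebraMap (algebraMap ℚ L).injective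
  -- `p` is a uniformiser of `ℚ_v`
  have hvp : (Rat.HeightOneSpectrum.primesEquiv v : ℕ) = p :=
    Rat.HeightOneSpectrum.primesEquiv_eq_of_natCast_mem v hp.out hpv
  have hirr := Literature.NumberTheory.Automorphic.irreducible_natCast_valuativeInteger_adicCompletion v
  rw [hvp] at hirr
  have hp0 : ((p : ℕ) : L) ≠ 0 := Nat.cast_ne_zero.mpr hp.out.ne_zero
  have hθ0 : θ ≠ 0 := fun h ↦ by rw [h, zero_pow he0] at hθ; exact hp0 hθ.symm
  have hζ1 : ζ - 1 ≠ 0 := sub_ne_zero.mpr (hζ.ne_one hp.out.one_lt)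
  -- `‖θ‖ = ‖(ζ − 1)^f‖`
  have hnormθ : algNorm F θ ^ e = algNorm F ((p : ℕ) : L) := by rw [← algNorm_pow, hθ]
  have hnormz : algNorm F ((ζ - 1) ^ f) ^ e = algNorm F ((p : ℕ) : L) := by
    rw [← algNorm_pow, ← pow_mul, mul_comm, hef, algNorm_pow, ← algNorm_neg, neg_sub]
    exact algNorm_one_sub_primitiveRoot_pow hζ
  have hnorm : algNorm F θ = algNorm F ((ζ - 1) ^ f) :=
    (pow_left_inj₀ (algNorm_nonneg _) (algNorm_nonneg _) he0).mp (hnormθ.trans hnormz.symm)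
  -- the Kummer character of inertia only sees `‖·‖`
  have h1 : residue F (σ • θ / θ) = residue F (σ • (ζ - 1) ^ f / (ζ - 1) ^ f) :=
    residue_smul_div_eq_of_algNorm_eq hσ hθ0 hnorm
  have h2 : σ • (ζ - 1) ^ f / (ζ - 1) ^ f = (σ • (ζ - 1) / (ζ - 1)) ^ f := by
    rw [absoluteGaloisGroup.smul_def, absoluteGaloisGroup.smul_def, map_pow, div_pow]
  -- `σ(ζ − 1)/(ζ − 1) ≡ N`
  have h3 := residue_smul_sub_one_div hirr hζ σ hN
  have hq1 : algNorm F (σ • (ζ - 1) / (ζ - 1)) ≤ 1 := (algNorm_smul_div_self σ hζ1).le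
  have hqθ : algNorm F (σ • θ / θ) ≤ 1 := (algNorm_smul_div_self σ hθ0).le
  have hnat : ∀ n : ℕ, algNorm F ((n : ℕ) : L) ≤ 1 := fun n ↦
    (spectralValuation_le_one_iff_algNorm_le_one (specVal_spec v) _).mp (specVal_natCast_le_one (v := v) n)
  have hNint : algNorm F ((N : ℕ) : L) ≤ 1 := hnat N
  have hresN : ∀ n : ℕ, residue F ((n : ℕ) : L) = (n : _) := by
    intro n
    induction n with
    | zero => rw [Nat.cast_zero, Nat.cast_zero, residue_zero]
    | succ n ih =>
      rw [Nat.cast_succ, Nat.cast_succ, residue_add (hnat n) (by rw [algNorm_one]), ih, residue_one]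
  -- residues of powers
  have hpowres : ∀ {x : L} (_ : algNorm F x ≤ 1) (n : ℕ), residue F (x ^ n) = residue F x ^ n := by
    intro x hx n
    induction n with
    | zero => rw [pow_zero, pow_zero, residue_one]
    | succ n ih =>
      have hxn : algNorm F (x ^ n) ≤ 1 := by rw [algNorm_pow]; exact pow_le_one₀ (algNorm_nonneg _) hx
      rw [pow_succ, residue_mul hxn hx, ih, pow_succ]
  have h4 : residue F (σ • θ / θ) = residue F (((N : ℕ) : L) ^ f) := by
    rw [h1, h2, hpowres hq1, h3, hpowres hNint, hresN N]
  have hNf : algNorm F (((N : ℕ) : L) ^ f) ≤ 1 := by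
    rw [algNorm_pow]; exact pow_le_one₀ (algNorm_nonneg _) hNint
  have hlt : algNorm F (σ • θ / θ - ((N : ℕ) : L) ^ f) < 1 := (residue_eq_residue_iff hqθ hNf).mp h4
  exact (spectralValuation_lt_one_iff_algNorm_lt_one (specVal_spec v) _).mpr hlt

end KummerCyclotomic

end Summit.BirchSwinnertonDyer.Rank1Residual.Additive.GoodModelLine

/-! ## §2 The quotient scalar of `σ` and `χ̄_p(σ)^{(p−1)/e}` have the same order -/

namespace Literature.NumberTheory.EllipticCurves.EmertonPollackWeston2006.IsRamifiedOrdinaryLine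

open NumberField IsDedekindDomain Field IsDedekindDomain.HeightOneSpectrum WeierstrassCurve
  Literature.NumberTheory.GaloisRepresentations Literature.NumberTheory.EllipticCurves
  Literature.NumberTheory.EllipticCurves.GreenbergSelmer
  Literature.NumberTheory.EllipticCurves.Rank1Residual
  Summit.BirchSwinnertonDyer.Rank1Residual.Additive
  Summit.BirchSwinnertonDyer.Rank1Residual.Additive.GoodModelLine
  Summit.BirchSwinnertonDyer.Rank1Residual.Additive.RamifiedOrdinaryLineInertiaScalars
  Summit.BirchSwinnertonDyer.Rank1Residual.X2.GreenbergVatsalReductionDatum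

variable {W : WeierstrassCurve ℚ} [W.IsElliptic] [W.IsGloballyMinimal] {p : ℕ} [hp : Fact p.Prime]
  {v : HeightOneSpectrum (𝓞 ℚ)}

omit [W.IsElliptic] [W.IsGloballyMinimal] hp in
/-- Iterating the quotient scalar: `grMk ((res σ)^j • x) = b^j • grMk x` (cc-typer-2's S3 step,
exported). [cite: GreenbergVatsal2000, §2 p. 26] -/
theorem grMk_pow_smul_eq_pow_nsmul {L : LocalDatum ℚ (W.geomPrimaryTorsion p) v}
    (σ : absoluteGaloisGroup (v.adicCompletion ℚ)) {x : W.geomPrimaryTorsion p} {b : ℕ}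
    (hb : L.grMk (absGaloisRestrict ℚ (v.adicCompletion ℚ) σ • x) = b • L.grMk x) (j : ℕ) :
    L.grMk ((absGaloisRestrict ℚ (v.adicCompletion ℚ) σ) ^ j • x) = b ^ j • L.grMk x := by
  set g := absGaloisRestrict ℚ (v.adicCompletion ℚ) σ with hg
  have hcomm : ∀ (c : ℕ) (z : W.geomPrimaryTorsion p), g • (c • z) = c • (g • z) := fun c z ↦
    map_nsmul (DistribSMul.toAddMonoidHom (W.geomPrimaryTorsion p) g) c z
  have hgC : ∀ c ∈ L.plus, L.grMk (g • c) = 0 := fun c hc ↦ by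
    rw [← AddMonoidHom.mem_ker, L.ker_grMk]; exact L.smul_mem σ hc
  induction j with
  | zero => rw [pow_zero, one_smul, pow_zero, one_nsmul]
  | succ j ih =>
    have hc : g ^ j • x - b ^ j • x ∈ L.plus := by
      rw [← L.ker_grMk, AddMonoidHom.mem_ker, map_sub, map_nsmul, ih, sub_self]
    have hstep : g ^ (j + 1) • x = b ^ j • (g • x) + g • (g ^ j • x - b ^ j • x) := by
      rw [pow_succ', mul_smul, smul_sub, hcomm, add_sub_cancel]
    rw [hstep, map_add, hgC _ hc, add_zero, map_nsmul, hb, ← mul_nsmul', ← pow_succ]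

/-- **THE QUOTIENT SCALAR OF `σ` AND `χ̄_p(σ)^{(p−1)/e}` HAVE THE SAME ORDER** (Gord_e346, `p ≥ 5`,
`e = semistabilityIndex W p ≠ 2`). For `E/ℚ` globally minimal, additive at `p` of type (G)-ordinary,
ANY ramified ordinary line `L` at `v ∋ p`, a local inertia element `σ`, a vector `x ∈ E[p^∞]` with
`x̄ ≠ 0`, `p x̄ = 0` in `E[p^∞]/C` and quotient scalar `b` (`res σ · x̄ = b · x̄`, cc-typer-2's S3
`exists_quotScalar`), a primitive `p`-th root of unity `ζ ∈ K̄_v` and `N` with `σ ζ = ζ^N`: for every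
`d`, **`b^d = 1 ↔ (N^{(p−1)/e})^d = 1` in `ℤ/p`**. (`b^d = 1` iff `σ^d` fixes `x̄` iff — freeness,
F3b — `σ^d` is trivial on `E[p^∞]/C` iff `σ^d θ = θ` for `θ^e = p` iff `η^d = 1`, `η = σθ/θ ∈ μ_e`,
iff — roots of unity of order prime to `p` are distinct mod `𝔪_w` — `η^d ≡ 1` iff `N^{fd} ≡ 1`
by §1.) So `ord ϑ̄(σ) = ord χ̄_p(σ)^{(p−1)/e}` for every `σ ∈ I_v`: r2's READING R-M exponent rule
in order form, per element, as a kernel theorem. [cite: Serre1972, §1.8 Prop. 8 and §5.6 (p. 312)]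
[cite: SerreTate1968, §2 Thm. 2 and Cor. 2] [cite: GreenbergVatsal2000, §2 p. 26] -/
theorem quotScalar_pow_eq_one_iff (hp5 : 5 ≤ p) (hG : TypeGOrd W p) (hadd : Addv W p)
    (he : semistabilityIndex W p ≠ 2) (hpv : ((p : ℕ) : 𝓞 ℚ) ∈ v.asIdeal)
    {L : LocalDatum ℚ (W.geomPrimaryTorsion p) v} (hL : IsRamifiedOrdinaryLine W p L)
    {σ : absoluteGaloisGroup (v.adicCompletion ℚ)} (hσ : σ ∈ absInertia (v.adicCompletion ℚ))
    {x : W.geomPrimaryTorsion p} (hx0 : L.grMk x ≠ 0) (hxp : p • L.grMk x = 0) {b : ℕ}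
    (hb : L.grMk (absGaloisRestrict ℚ (v.adicCompletion ℚ) σ • x) = b • L.grMk x)
    {ζ : AlgebraicClosure (v.adicCompletion ℚ)} (hζ : IsPrimitiveRoot ζ p) {N : ℕ}
    (hN : σ • ζ = ζ ^ N) (d : ℕ) :
    ((b : ZMod p)) ^ d = 1 ↔
      (((N : ZMod p)) ^ ((p - 1) / semistabilityIndex W p)) ^ d = 1 := by
  let K := AlgebraicClosure (v.adicCompletion ℚ)
  haveI : CharZero K := charZero_of_injective_algebraMap (algebraMap ℚ K).injective
  set e : ℕ := semistabilityIndex W p with hedef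
  set f : ℕ := (p - 1) / semistabilityIndex W p with hfdef
  have he0 : e ≠ 0 := semistabilityIndex_ne_zero p W
  have hpe : ¬ p ∣ e := not_dvd_semistabilityIndex p W hp5
  have hedvd : e ∣ p - 1 := ((typeG_iff_not_subM_and_semistabilityIndex_dvd W p hp5).mp hG.typeG).2
  have hef : e * f = p - 1 := Nat.mul_div_cancel' hedvd
  have hp0 : ((p : ℕ) : K) ≠ 0 := Nat.cast_ne_zero.mpr hp.out.ne_zero
  -- `θ = p^{1/e}`, `η = σθ/θ ∈ μ_e`, fixed by inertia
  obtain ⟨θ, hθ⟩ := IsAlgClosed.exists_pow_nat_eq ((p : ℕ) : K) (Nat.pos_of_ne_zero he0)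
  have hθ0 : θ ≠ 0 := fun h ↦ by rw [h, zero_pow he0] at hθ; exact hp0 hθ.symm
  set η : K := σ • θ / θ with hη
  have hση : σ • θ = η * θ := by rw [hη, div_mul_cancel₀ _ hθ0]
  have hηe : η ^ e = 1 := by
    rw [hη, div_pow, absoluteGaloisGroup.smul_def, ← map_pow, hθ, map_natCast, div_self hp0]
  have hσfixη : σ • η = η := smul_eq_self_of_pow_eq_one p hpv he0 hpe hηe hσ
  have hpowθ : ∀ j : ℕ, (σ ^ j) • θ = η ^ j * θ := pow_smul_eq_pow_mul hση hσfixη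
  -- N ≠ 0 (σζ is again a primitive root)
  have hN0 : 1 ≤ N := by
    rcases Nat.eq_zero_or_pos N with h | h
    · exfalso
      rw [h, pow_zero, absoluteGaloisGroup.smul_def] at hN
      have h1 : ζ = 1 := (absoluteGaloisGroup.toAlgEquiv _ σ).injective (by rw [hN, map_one])
      exact hζ.ne_one hp.out.one_lt h1
    · exact h
  -- LHS: `b^d = 1 ↔ σ^d` trivial on `E[p^∞]/C`
  have hLHS : ((b : ZMod p)) ^ d = 1 ↔
      ∀ m : W.geomPrimaryTorsion p,
        absGaloisRestrict ℚ (v.adicCompletion ℚ) (σ ^ d) • m - m ∈ L.plus := by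
    constructor
    · intro hbd
      -- `σ^d` fixes `x̄`, hence (freeness) fixes `θ`, hence is trivial
      have hfix : absGaloisRestrict ℚ (v.adicCompletion ℚ) (σ ^ d) • x - x ∈ L.plus := by
        rw [map_pow, ← L.ker_grMk, AddMonoidHom.mem_ker, map_sub, grMk_pow_smul_eq_pow_nsmul σ hb d,
          sub_eq_zero]
        -- `b^d ≡ 1 (mod p)` and `p x̄ = 0`
        have hmod : (b ^ d) % p = 1 % p := by
          have h1 : (((b ^ d : ℕ)) : ZMod p) = ((1 : ℕ) : ZMod p) := by
            rw [Nat.cast_pow, Nat.cast_one]; exact hbd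
          exact (ZMod.natCast_eq_natCast_iff' _ _ _).mp h1
        have hord : addOrderOf (L.grMk x) ∣ p := addOrderOf_dvd_of_nsmul_eq_zero hxp
        have hpq : (p * (b ^ d / p)) • L.grMk x = 0 :=
          addOrderOf_dvd_iff_nsmul_eq_zero.mp (hord.trans (dvd_mul_right p _))
        rw [← Nat.mod_add_div (b ^ d) p, add_nsmul, hpq, add_zero, hmod,
          Nat.one_mod_eq_one.mpr hp.out.ne_one, one_nsmul]
      have hx : x ∉ L.plus := fun h ↦ hx0 (by rw [← AddMonoidHom.mem_ker, L.ker_grMk]; exact h)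
      have hτθ : (σ ^ d) • θ = θ :=
        smul_eq_of_smul_sub_mem_plus hp5 hG hadd he hpv hL hθ (Subgroup.pow_mem _ hσ d) hx hfix
      exact (forall_smul_sub_mem_plus_iff_smul_eq hp5 hG hadd he hpv hL hθ (Subgroup.pow_mem _ hσ d)).2 hτθ
    · intro htriv
      have h := quotScalar_pow_eq_one σ (n := d) (fun m ↦ by rw [← map_pow]; exact htriv m) hx0 hxp hb
      exact h
  -- middle: `σ^d` trivial ↔ `η^d = 1`
  have hMID : (∀ m : W.geomPrimaryTorsion p,
      absGaloisRestrict ℚ (v.adicCompletion ℚ) (σ ^ d) • m - m ∈ L.plus) ↔ η ^ d = 1 := by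
    rw [forall_smul_sub_mem_plus_iff_smul_eq hp5 hG hadd he hpv hL hθ (Subgroup.pow_mem _ hσ d), hpowθ d]
    exact ⟨fun h ↦ mul_right_cancel₀ hθ0 (h.trans (one_mul θ).symm), fun h ↦ by rw [h, one_mul]⟩
  -- RHS: `η^d = 1 ↔ |η^d − 1| < 1 ↔ |N^{fd} − 1| < 1 ↔ (N^f)^d = 1 in ℤ/p`
  have hηN : specVal v (η - ((N : ℕ) : K) ^ f) < 1 :=
    specVal_smul_div_sub_pow_lt_one p hpv he0 hef hθ hζ hσ hN
  have hηle : specVal v η ≤ 1 := by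
    have h : specVal v η ^ e = 1 := by rw [← map_pow, hηe, map_one]
    exact ((pow_eq_one_iff.mp h).resolve_right he0).le
  have hNle : specVal v (((N : ℕ) : K) ^ f) ≤ 1 := by
    rw [map_pow]; exact pow_le_one₀ zero_le (specVal_natCast_le_one (v := v) N)
  have hpow : specVal v (η ^ d - (((N : ℕ) : K) ^ f) ^ d) < 1 :=
    specVal_pow_sub_pow_lt_one hηle hNle hηN d
  have hRHS : η ^ d = 1 ↔ (((N : ZMod p)) ^ f) ^ d = 1 := by
    have hM : 1 ≤ (N ^ f) ^ d := Nat.one_le_pow _ _ (Nat.one_le_pow _ _ hN0)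
    have hz := natCast_zmod_eq_one_iff_specVal_sub_one_lt_one p hpv hM
    rw [Nat.cast_pow, Nat.cast_pow] at hz
    rw [hz, Nat.cast_pow, Nat.cast_pow]
    constructor
    · intro h1
      -- `|N^{fd} − 1| ≤ max(|N^{fd} − η^d|, |η^d − 1|)`
      have hsplit : (((N : ℕ) : K) ^ f) ^ d - 1 = ((((N : ℕ) : K) ^ f) ^ d - η ^ d) + (η ^ d - 1) := by ring
      rw [hsplit]
      refine Valuation.map_add_lt _ ?_ ?_
      · rw [← Valuation.map_neg, neg_sub]; exact hpow
      · rw [h1, sub_self, map_zero]; exact one_pos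
    · intro h1
      have hηd1 : specVal v (η ^ d - 1) < 1 := by
        have hsplit : η ^ d - 1 = (η ^ d - (((N : ℕ) : K) ^ f) ^ d) + ((((N : ℕ) : K) ^ f) ^ d - 1) := by
          ring
        rw [hsplit]
        exact Valuation.map_add_lt _ hpow h1
      have hηde : (η ^ d) ^ e = 1 := by rw [← pow_mul, mul_comm, pow_mul, hηe, one_pow]
      exact eq_one_of_pow_eq_one_of_specVal_sub_one_lt p hpv he0 hηde hηd1 hpe
  exact hLHS.trans (hMID.trans hRHS)

end Literature.NumberTheory.EllipticCurves.EmertonPollackWeston2006.IsRamifiedOrdinaryLine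

/-! ## §3 Class forms -/

namespace Summit.BirchSwinnertonDyer.Rank1Residual.Additive

open NumberField IsDedekindDomain Field IsDedekindDomain.HeightOneSpectrum WeierstrassCurve
  Literature.NumberTheory.GaloisRepresentations Literature.NumberTheory.EllipticCurves
  Literature.NumberTheory.EllipticCurves.GreenbergSelmer
  Literature.NumberTheory.EllipticCurves.EmertonPollackWeston2006
  Literature.NumberTheory.EllipticCurves.Rank1Residual

variable {W : WeierstrassCurve ℚ} [W.IsElliptic] [W.IsGloballyMinimal] {p : ℕ} [hp : Fact p.Prime]
  {v : HeightOneSpectrum (𝓞 ℚ)}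

/-- **X4♯(G-ord), `p ≥ 5`, `e ≠ 2`: the quotient scalar of every inertial `σ` has the order of
`χ̄_p(σ)^{(p−1)/e}`.** Nothing booked. [cite: Serre1972, §1.8 Prop. 8 and §5.6 (p. 312)] -/
theorem ClassX4Gord.quotScalar_pow_eq_one_iff (hX : ClassX4Gord W p) (hp5 : 5 ≤ p)
    (he : semistabilityIndex W p ≠ 2) (hpv : ((p : ℕ) : 𝓞 ℚ) ∈ v.asIdeal)
    {L : LocalDatum ℚ (W.geomPrimaryTorsion p) v} (hL : IsRamifiedOrdinaryLine W p L)
    {σ : absoluteGaloisGroup (v.adicCompletion ℚ)} (hσ : σ ∈ absInertia (v.adicCompletion ℚ))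
    {x : W.geomPrimaryTorsion p} (hx0 : L.grMk x ≠ 0) (hxp : p • L.grMk x = 0) {b : ℕ}
    (hb : L.grMk (absGaloisRestrict ℚ (v.adicCompletion ℚ) σ • x) = b • L.grMk x)
    {ζ : AlgebraicClosure (v.adicCompletion ℚ)} (hζ : IsPrimitiveRoot ζ p) {N : ℕ}
    (hN : σ • ζ = ζ ^ N) (d : ℕ) :
    ((b : ZMod p)) ^ d = 1 ↔ (((N : ZMod p)) ^ ((p - 1) / semistabilityIndex W p)) ^ d = 1 :=
  hL.quotScalar_pow_eq_one_iff hp5 hX.typeGOrd hX.addv.2 he hpv hσ hx0 hxp hb hζ hN d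

/-- **X3♯(G-ord), `p ≥ 5`, `e ≠ 2`: the quotient scalar of every inertial `σ` has the order of
`χ̄_p(σ)^{(p−1)/e}`.** Nothing booked. [cite: Serre1972, §1.8 Prop. 8 and §5.6 (p. 312)] -/
theorem ClassX3Gord.quotScalar_pow_eq_one_iff (hX : ClassX3Gord W p) (hp5 : 5 ≤ p)
    (he : semistabilityIndex W p ≠ 2) (hpv : ((p : ℕ) : 𝓞 ℚ) ∈ v.asIdeal)
    {L : LocalDatum ℚ (W.geomPrimaryTorsion p) v} (hL : IsRamifiedOrdinaryLine W p L)
    {σ : absoluteGaloisGroup (v.adicCompletion ℚ)} (hσ : σ ∈ absInertia (v.adicCompletion ℚ))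
    {x : W.geomPrimaryTorsion p} (hx0 : L.grMk x ≠ 0) (hxp : p • L.grMk x = 0) {b : ℕ}
    (hb : L.grMk (absGaloisRestrict ℚ (v.adicCompletion ℚ) σ • x) = b • L.grMk x)
    {ζ : AlgebraicClosure (v.adicCompletion ℚ)} (hζ : IsPrimitiveRoot ζ p) {N : ℕ}
    (hN : σ • ζ = ζ ^ N) (d : ℕ) :
    ((b : ZMod p)) ^ d = 1 ↔ (((N : ZMod p)) ^ ((p - 1) / semistabilityIndex W p)) ^ d = 1 :=
  hL.quotScalar_pow_eq_one_iff hp5 hX.typeGOrd hX.addv he hpv hσ hx0 hxp hb hζ hN d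

end Summit.BirchSwinnertonDyer.Rank1Residual.Additive

end
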